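import Summits.ResolutionOfSingularities.Statement
import Literature.AlgebraicGeometry.Resolution.BlowupSequencesExtensions
import Summits.ResolutionOfSingularities.ResolutionOfSingularities.Theorems.PurityValveClasses
import Summits.ResolutionOfSingularities.ResolutionOfSingularities.Theorems.ForcedTowerClasses
import Summits.ResolutionOfSingularities.ResolutionOfSingularities.Theorems.WeakOrderReduction
import Summits.ResolutionOfSingularities.ResolutionOfSingularities.Theorems.FrobeniusBracketPow
import Summits.ResolutionOfSingularities.ResolutionOfSingularities.Theorems.MonomialTowerClasses
import Summits.ResolutionOfSingularities.ResolutionOfSingularities.Theorems.DivergentTowerClasses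

/-!
# SatelliteExitClasses — node «SatelliteExit» (decomp-res · lens-6 «barrier-complement carving» · generation 11)

g11 node beneath the tree's pure game `MaxContactCut.PVPureGame` (31574) = `∀ n ≥ 1, PurityValveClasses.WORPure n`
at its only live marking `n = 3` (`p = 3`, dim ≤ 4), i.e. beneath g9's `WORPure 3` and g10's located residual
`SatelliteCut.WORPureSat3` (satellite-capable pure cube points).  REBASED: every g9 notion is the TREE's
(`Theorems/PurityValveClasses`, `Theorems/MaxContactCutPurityValve`), nothing restated.

## Thesis (one line)
`WORPure 3 ⟸ PureEngine3 ∧ SeqDimFour 2 3 ∧ NoEscapingBranch3`, and `NoEscapingBranch3 ⟺ FrameUnstable3 ∧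
ShadowFree3 ∧ ShadowRegular3 ∧ ShadowSingular3` (PROVED, excluded middle), where the g11 desk theorems decide
`ShadowFree3` (exit lines at free/double points + the cube corner theorem) and `ShadowRegular3` (inert variable),
locating the residual in `ShadowSingular3` (escaping pure branches hugging, inside a hypersurface of permanent
contact, only SINGULAR surface germs) and `FrameUnstable3` (escaping pure branches with NO hypersurface of permanent
contact — the cube-head shadow of Moh's phenomenon).

## Answer to the critic's test T-sat-tower-3x (row 65)
«can the satellite corner condition be met twice running?» — YES, indefinitely: `satelliteRecurs_w/x` below are the
ring identities `f(xw,yw,zw,w) = w³ f`, `f(x,yx,zx,wx) = x³ f` for the PURE cube head `f = z³ + xy²w + xyzw`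
(Hasse invariant `[x²y²w²] f₄² = 1`): the alternating `∂_w/∂_x` point tower is an infinite all-newest-satellite pure
core tower reproducing `f` verbatim.  So «satellite moves cannot recur» is FALSE as a pointwise statement — but the
curve-priority ENGINE never builds that tower: at every stage the exceptional line `{u = y = z = 0}` has `ν = 3`
(EXIT LINE, globally a projective line in `E_u ≅ ℙ³`), so rule (b″) blows up the line and the point dies childless
(T3).  The g11 object is therefore the EXIT LINE, and the residual is re-located from «satellite-capable points»
(a class of points) to «escaping branches» (a class of infinite branches of the engine's core forest with no exit
line at any point round), cut by what the branch HUGS.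

## Pieces (tags) — see each docstring
* `PureCoreElimination3` — EQUIV layer: `WORPure 3 ⟺ PureCoreElimination3` (PROVED mod `BaseStable`, `SeqDimFour 2 3`).
* `PureEngine3` (port, DESK-DECIDED: g10 §4.6 engine + T3 + persistence of exit lines under foreign rounds + König)
  · `NoEscapingBranch3` (UNDECIDED, the tower form of the pure game at `p = 3`).
* split of `NoEscapingBranch3` (kernel `noEscaping_iff_leaves`, PROVED):
  `FrameUnstable3` (UNDECIDED · RESIDUAL-2 · INSTRUMENTABLE T-frame) · `ShadowFree3` (DESK-DECIDED g11, NEW: pencil /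
  corner-line exits + `NoCubeCornerTower`) · `ShadowRegular3` (DESK-DECIDED g11, NEW mechanism: inert variable;
  overlaps lens-4 g11's Surface Law) · `ShadowSingular3` (UNDECIDED · THE LOCATED RESIDUAL · ATTACKABLE: Beppo-Levi /
  CJS-type «infinitely near m-fold points of an embedded surface lie eventually on an m-fold curve» ⇒ curve hugging ⇒
  free tail ⇒ g10 Case A; converges with lens-4 g11 `SingularSurfaceHuggingTowersTerminate`).
* `NoCubeCornerTower` (support, typed over the TREE's `MonomialTowerClasses.CornerTower 4 3`; DESK+MACHINE-DECIDED:
  exhaustive search words ≤ 10 / degree ≤ 22 / 0 violations + two truncation lemmas; Lean ATTACKABLE-S; WEAKER by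
  letter than the tree leaf `NoCornerTower 4 3`, kernel `noCube_of_noCornerTower`).
* asides (PROVED): `satelliteRecurs_w`, `satelliteRecurs_x` (recurrence certificates); `pureForced_of_worPure`
  (the forced shadow of the residual is target-implied, mod the tree port `TowerObstructs 3`).

## Why each piece is strictly weaker than its parent, and why this is novel — see NODE-g11.md §2–§4.

[WRITER NOTE (decomp-res writer g4, node N61).  This file = the lens's §§1–4 VERBATIM (vocabulary, the EQUIV layer
`WORPure 3 ⟺ PureCoreElimination3`, the NEW OBJECT `Branch` with exit lines / escaping branches, the four-leaf cut
`noEscaping_iff_leaves`, the cube-corner support piece), renamed from the lens namespace `…Theses.SatelliteExit` to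
`…Theorems.SatelliteExitClasses`; the recurrence certificates (§5) and the Theses-free necessity / forced-shadow
kernels are `Theorems/SatelliteExitKernels`; the wiring to the route items 31574 / 29273 / 28544 BY NAME is
`Theorems/MaxContactCutSatelliteExit`; the route asides are `MaxContactCut.SENoEscapingBranch3`,
`SEFrameUnstable3`, `SEShadowSingular3`, `SEShadowFree3`, `SEShadowRegular3`.  The desk proofs quoted in the
docstrings (NODE-g11.md §4) are the PROVER BLUEPRINTS for the pieces tagged DESK-DECIDED; nothing tagged UNDECIDED is
claimed.  FIDELITY CAVEAT recorded by the critic (row 74): `ContactFrom` demands a PRINCIPAL stalk `𝓘_pt = (φ)`, so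
non-principal pure core branches are typed into `FrameUnstable3` — read that leaf accordingly.  SUPERSEDES the g10
located residual `SatelliteCut.WORPureSat3` (TREE.md).  (Sources: CossartPiltant2008 §4; CossartJannsenSaito2020
Thm 5.30, Cor 5.37; Moh1987; Hauser2010 — cited in text only.)]
-/

namespace Summit.ResolutionOfSingularities.ResolutionOfSingularities.Theorems.SatelliteExitClasses

open CategoryTheory AlgebraicGeometry
open Literature.AlgebraicGeometry.Resolution
open Summit.ResolutionOfSingularities.ResolutionOfSingularities.Theorems
open WeakOrderReduction ForcedTowerClasses PurityValveClasses FrobeniusBracketPow MonomialTowerClasses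
open DivergentTowerClasses

/-! ## §1 The scheme-level EQUIV layer: `WORPure 3 ⟺ PureCoreElimination3` -/

/-- After a weak resolution no point has order `≥ n` (empty final support). [folklore] -/
theorem no_top_point_of_weakResolution {n : ℕ} {Y : Scheme.{0}} (t : CentreSeq Y) (M : MarkedIdeal Y)
    (hM : IsDatum n M) (ht : WeakResolution t M) :
    ∀ y : t.top, ¬ ((n : ℕ) : ℕ∞) ≤ idealOrder (t.transformMarked M).ideal y := by
  intro y hy
  have hmult : (t.transformMarked M).mult = n := (CentreSeq.transformMarked_mult t M).trans hM.1
  have hmem : y ∈ (t.transformMarked M).support := by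
    rw [MarkedIdeal.mem_support_iff, hmult]
    exact (le_idealOrder_iff _ _ _).1 hy
  rw [ht.2] at hmem
  exact hmem

/-- **piece · `PureCoreElimination3`** — from a marking-3 datum on a dim-`≤ 4` base ALL of whose core points are pure,
some weakly admissible sequence reaches a base of the class carrying an order-`≤ 3` datum with NO core point (every
order-3 point has class ≥ 2).  EQUIV layer: `WORPure 3 ⟺ PureCoreElimination3` (kernels `elim_of_worPure` mod
`BaseStable`, `worPure_of_elim` mod the booked `SeqDimFour 2 3`).  g10's `TamePureCoreElimination3` is its tame
slice.  UNDECIDED; cut below by the engine port and the tower leaves. (Sources: CossartJannsenSaito2020, Cor 5.37.) -/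
def PureCoreElimination3 : Prop :=
  ∀ p : ℕ, p.Prime → ∀ (k : Type) [Field k] [CharP k p] (Y : Scheme.{0}) (g : Y ⟶ Spec (.of k))
    (hB : IsBase Y g), ∀ M : MarkedIdeal Y, IsDatum 3 M → AllCorePure p g hB.isRegular M.ideal 3 →
      ∃ t : CentreSeq Y, WeakAdmissible t M ∧ ∃ hB' : IsBase t.top (t.comp ≫ g),
        IsDatum 3 (t.transformMarked M) ∧
        ∀ y' : t.top, idealOrder (t.transformMarked M).ideal y' = ((3 : ℕ) : ℕ∞) →
          ClassGE (t.comp ≫ g) hB'.isRegular (t.transformMarked M).ideal 3 2 y'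

/-- NECESSITY: `WORPure 3 ⟹ PureCoreElimination3` (a weak resolution eliminates every top point; mod `BaseStable`).
[folklore] -/
theorem elim_of_worPure (hS : BaseStable) (h : WORPure 3) : PureCoreElimination3 := by
  intro p hp k _ _ Y g hB M hM hpure
  obtain ⟨t, hadm, hsupp⟩ := h p hp k Y g hB M hM hpure
  have hB' : IsBase t.top (t.comp ≫ g) := isBase_top hS t g M hB hadm
  have hmult : (t.transformMarked M).mult = 3 := (CentreSeq.transformMarked_mult t M).trans hM.1
  have hlt := no_top_point_of_weakResolution t M hM ⟨hadm, hsupp⟩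
  refine ⟨t, hadm, hB', ⟨hmult, fun y => le_of_lt (not_le.mp (hlt y))⟩, ?_⟩
  intro y hy
  exact absurd (le_of_eq hy.symm) (hlt y)

/-- The finishing piece is the tree's `SeqDimFour 2 3` BY NAME (the marking-3 slice of `E 2`, BOOKED). [folklore] -/
theorem seqDimFour_two_three_of_e_two (h2 : E 2) : SeqDimFour 2 3 :=
  h2 3 (by norm_num)

/-- SUFFICIENCY (kernel): `PureCoreElimination3 → SeqDimFour 2 3 → WORPure 3` — eliminate the core points, then finish
the class-≥2 datum (weak resolutions ignore the boundary: `weakResolution_congr`). [folklore] -/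
theorem worPure_of_elim (hE : PureCoreElimination3) (h23 : SeqDimFour 2 3) : WORPure 3 := by
  intro p hp k _ _ Y g hB M hM hpure
  obtain ⟨t, hadm, hB', hM', hcls⟩ := hE p hp k Y g hB M hM hpure
  obtain ⟨t', ht'⟩ := h23 p hp k t.top (t.comp ≫ g) hB'.isSeparated hB'.locallyOfFiniteType hB'.quasiCompact
    hB'.isRegular hB'.dim_le (t.transformMarked M).ideal hM'.2 (fun y hy => hcls y hy)
  have ht'' : WeakResolution t' (t.transformMarked M) :=
    (weakResolution_congr t' (t.transformMarked M) ⟨(t.transformMarked M).ideal, [], 3⟩ rfl hM'.1).2 ht'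
  exact ⟨seqAppend t t', weakResolution_seqAppend t t' M hadm ht''⟩

/-- **EXACTNESS OF THE EQUIV LAYER** (mod `BaseStable`, given the booked `SeqDimFour 2 3`). [folklore] -/
theorem worPure_three_iff_elim (hS : BaseStable) (h23 : SeqDimFour 2 3) : WORPure 3 ↔ PureCoreElimination3 :=
  ⟨elim_of_worPure hS, fun h => worPure_of_elim h h23⟩

/-! ## §2 THE NEW OBJECT: branches of the engine's core forest, exit lines, escaping branches -/

/-- A BRANCH of the curve-priority engine's core forest (NODE-g10.md §4.6, NODE-g11.md §3): stages `St i` with their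
`k`-structure maps, marked ideals `D i` (controlled transforms), the followed core points `pt i ↦ pt (i-1)`, and the
engine's rounds `π i` = blow-up of a regular weakly admissible centre which is EITHER exactly the point `pt i` (a POINT
ROUND of the branch) OR misses `pt i` (a FOREIGN round: a (b″)/(c′) centre elsewhere in the forest); infinitely many
point rounds (an infinite branch).  No isolation is required (this is not a `ForcedTower`). DEFINITION (support). -/
structure Branch (k : Type) [Field k] where
  /-- the stages -/
  St : ℕ → Scheme.{0}
  /-- the structure maps -/
  str : ∀ i, St i ⟶ Spec (.of k)
  /-- every stage is a base of the class -/
  base : ∀ i, IsBase (St i) (str i)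
  /-- the marked ideals (controlled transforms) -/
  D : ∀ i, MarkedIdeal (St i)
  /-- the followed points -/
  pt : ∀ i, St i
  /-- the centres of the engine's rounds -/
  centre : ∀ i, (St i).IdealSheafData
  /-- the blow-ups -/
  π : ∀ i, St (i + 1) ⟶ St i
  isClosed_pt : ∀ i, IsClosed ({pt i} : Set (St i))
  centre_regular : ∀ i, Scheme.IsRegular (centre i).subscheme
  centre_adm : ∀ i, ((centre i).support : Set (St i)) ⊆ (D i).support
  isBlowup : ∀ i, IsBlowup (π i) (centre i)
  str_comp : ∀ i, str (i + 1) = π i ≫ str i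
  transform_eq : ∀ i, D (i + 1) = (D i).transform (π i) (centre i)
  pt_map : ∀ i, (π i).base (pt (i + 1)) = pt i
  kind : ∀ i, ((centre i).support : Set (St i)) = {pt i} ∨ pt i ∉ ((centre i).support : Set (St i))
  io : ∀ i₀, ∃ i, i₀ ≤ i ∧ ((centre i).support : Set (St i)) = {pt i}

variable {k : Type} [Field k]

/-- Round `i` is a POINT ROUND of the branch (the centre is exactly `pt i`). -/
def Branch.PointRound (B : Branch k) (i : ℕ) : Prop :=
  ((B.centre i).support : Set (B.St i)) = {B.pt i}

/-- **EXIT LINE at stage `i`**: a globally regular curve `C ∋ pt i` (positive-dimensional at `pt i`) inside the top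
locus `supp (D i)` AND inside a boundary component (an exceptional divisor) — the centre rule (b″) may blow up `C`,
after which no core point lies over `pt i` (T3, g10 `PureCurveExit3`).  In coordinates: a line `{u = y = z = 0}` of
`E_u ≅ ℙ³` with `ν_L(f) ≥ 3`. DEFINITION (support). -/
def ExitLineAt (B : Branch k) (i : ℕ) : Prop :=
  ∃ C : (B.St i).IdealSheafData, Scheme.IsRegular C.subscheme ∧ B.pt i ∈ (C.support : Set (B.St i)) ∧
    ¬ IsIsolatedIn (C.support : Set (B.St i)) (B.pt i) ∧ (C.support : Set (B.St i)) ⊆ (B.D i).support ∧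
    ∃ E ∈ (B.D i).boundary, (C.support : Set (B.St i)) ⊆ (E.support : Set (B.St i))

/-- Every followed point is a CORE point of its stage. -/
def Branch.Core (B : Branch k) : Prop :=
  ∀ i, IsCorePt (B.str i) (B.base i).isRegular (B.D i).ideal 3 (B.pt i)

/-- Every followed point is Fedder-pure. -/
def Branch.Pure (B : Branch k) (p : ℕ) : Prop :=
  ∀ i, ¬ FedderImpureAt (B.D i).ideal p (B.pt i)

/-- ESCAPING: at no point round does the followed point carry an exit line (else (b″) had priority and the branch
would have died there). -/
def Branch.Escaping (B : Branch k) : Prop :=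
  ∀ i, B.PointRound i → ¬ ExitLineAt B i

/-- «No infinite escaping pure core branch of the class at marking 3 satisfies `P`.» -/
def NoBranch3 (P : ∀ (k : Type) [Field k], Branch k → Prop) : Prop :=
  ∀ p : ℕ, p.Prime → ∀ (k : Type) [Field k] [CharP k p] (B : Branch k),
    IsDatum 3 (B.D 0) → AllCorePure p (B.str 0) (B.base 0).isRegular (B.D 0).ideal 3 →
      B.Core → B.Pure p → B.Escaping → P k B → False

/-- pure logic: `NoBranch3` is antitone in the predicate. [folklore] -/
theorem noBranch3_mono {P Q : ∀ (k : Type) [Field k], Branch k → Prop}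
    (hPQ : ∀ (k : Type) [Field k] (B : Branch k), Q k B → P k B) (h : NoBranch3 P) : NoBranch3 Q :=
  fun p hp k _ _ B hD hA hC hPu hE hQ => h p hp k B hD hA hC hPu hE (hPQ k B hQ)

/-- pure logic: a predicate covered by two pieces. [folklore] -/
theorem noBranch3_of_cover {P Q R : ∀ (k : Type) [Field k], Branch k → Prop}
    (hcov : ∀ (k : Type) [Field k] (B : Branch k), R k B → P k B ∨ Q k B) (hP : NoBranch3 P) (hQ : NoBranch3 Q) :
    NoBranch3 R := by
  intro p hp k _ _ B hD hA hC hPu hE hR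
  rcases hcov k B hR with h | h
  · exact hP p hp k B hD hA hC hPu hE h
  · exact hQ p hp k B hD hA hC hPu hE h

/-- **piece · `NoEscapingBranch3`** — no infinite escaping pure core branch at marking 3 (dim ≤ 4).  The tower form
of the pure game at `p = 3` (for `p ≠ 3` there are no core points at marking 3).  UNDECIDED · cut below.
(Sources: CossartPiltant2008, §4; Moh1987.) -/
def NoEscapingBranch3 : Prop := NoBranch3 fun _ _ _ => True

/-- **port · `PureEngine3`** — THE ENGINE THEOREM (NODE-g11.md §3; g10 §4.6): run the curve-priority engine ((b″):
blow up a globally regular top-locus curve through a core point — kills it childless by T3 = g10 `PureCurveExit3` and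
creates no core point (class persistence, `NearPointLift 3`); (c′): else blow up Sing(core-carrying top curves) ∪
isolated core points; purity persists by `CartierLift`); exit lines persist under foreign rounds (generic point
untouched, strict transform of a regular curve regular, top locus closed); so if the engine runs for ever König gives an
infinite branch all of whose point rounds are exit-free, i.e. an escaping pure core branch.  DESK-DECIDED mod the g9/g10
ports; COSTUME-grade (an implication between typed pieces, counted 0). (Sources: CossartPiltant2008, §4;
CossartJannsenSaito2020, Cor 5.37.) -/
def PureEngine3 : Prop := NoEscapingBranch3 → PureCoreElimination3

/-- kernel: engine + no escaping branch ⟹ elimination. [folklore] -/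
theorem elim_of_engine (hE : PureEngine3) (hN : NoEscapingBranch3) : PureCoreElimination3 := hE hN

/-- kernel: … ⟹ `WORPure 3` BY NAME. [folklore] -/
theorem worPure_of_engine (hE : PureEngine3) (h23 : SeqDimFour 2 3) (hN : NoEscapingBranch3) : WORPure 3 :=
  worPure_of_elim (elim_of_engine hE hN) h23

/-! ## §3 What an escaping branch hugs: permanent contact, the shadow, and the four leaves -/

/-- Iterated STRICT transform along the branch of a germ ideal `H` on stage `m` (foreign rounds included). -/
noncomputable def strictIter (B : Branch k) (m : ℕ) (H : (B.St m).IdealSheafData) :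
    (j : ℕ) → (B.St (m + j)).IdealSheafData
  | 0 => H
  | j + 1 => strictTransformIdeal (B.π (m + j)) (B.centre (m + j)) (strictIter B m H j)

/-- The branch HUGS THE GERM `V(H) ∋ pt m` for ever. -/
def HugsGerm (B : Branch k) (m : ℕ) (H : (B.St m).IdealSheafData) : Prop :=
  idealOrder H (B.pt m) ≠ ⊤ ∧ ∀ j, B.pt (m + j) ∈ ((strictIter B m H j).support : Set (B.St (m + j)))

/-- **PERMANENT CONTACT from stage `m`**: a regular hypersurface germ `V(Z) ∋ pt m`, `Z_{pt m} = (z)`, which is a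
CONTACT HYPERPLANE of the cube point (`𝓘_{pt m} = (φ)`, `φ ≡ z³ mod 𝔪⁴`: the directrix is `{z = 0}`)
and is hugged for
ever (no further re-framing event `z ↦ z + c·u`, NODE-g11.md §4.2). DEFINITION (support). -/
def ContactFrom (B : Branch k) (m : ℕ) (Z : (B.St m).IdealSheafData) : Prop :=
  HugsGerm B m Z ∧ ∃ φ z : (B.St m).presheaf.stalk (B.pt m),
    stalkIdeal (B.D m).ideal (B.pt m) = Ideal.span {φ} ∧ stalkIdeal Z (B.pt m) = Ideal.span {z} ∧
    z ∈ IsLocalRing.maximalIdeal _ ∧ z ∉ IsLocalRing.maximalIdeal _ ^ 2 ∧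
    φ - z ^ 3 ∈ IsLocalRing.maximalIdeal _ ^ 4

/-- The branch is FRAME-STABLE: it acquires a hypersurface of permanent contact at some stage. -/
def FrameStable (B : Branch k) : Prop :=
  ∃ (m : ℕ) (Z : (B.St m).IdealSheafData), ContactFrom B m Z

/-- The SHADOW HUGS A SURFACE: inside a hypersurface of permanent contact the branch hugs, from some later stage on,
a two-dimensional germ `V(S) ⊆ V(Z̃)` (`Z̃` the strict transform of `Z`). -/
def ShadowHugsSurface (B : Branch k) : Prop :=
  ∃ (m : ℕ) (Z : (B.St m).IdealSheafData), ContactFrom B m Z ∧ ∃ (j : ℕ) (S : (B.St (m + j)).IdealSheafData),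
    strictIter B m Z j ≤ S ∧ HugsGerm B (m + j) S ∧
      ringKrullDim ((B.St (m + j)).presheaf.stalk (B.pt (m + j)) ⧸ stalkIdeal S (B.pt (m + j))) = (2 : WithBot ℕ∞)

/-- The SHADOW HUGS A REGULAR SURFACE (an INERT VARIABLE `y`: `S_{pt} = (z̃, y)` with regular quotient). -/
def ShadowHugsRegularSurface (B : Branch k) : Prop :=
  ∃ (m : ℕ) (Z : (B.St m).IdealSheafData), ContactFrom B m Z ∧ ∃ (j : ℕ) (S : (B.St (m + j)).IdealSheafData),
    strictIter B m Z j ≤ S ∧ HugsGerm B (m + j) S ∧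
      ringKrullDim ((B.St (m + j)).presheaf.stalk (B.pt (m + j)) ⧸ stalkIdeal S (B.pt (m + j))) = (2 : WithBot ℕ∞) ∧
      IsRegularLocalRing ((B.St (m + j)).presheaf.stalk (B.pt (m + j)) ⧸ stalkIdeal S (B.pt (m + j)))

/-- pure logic. [folklore] -/
theorem shadowHugsSurface_of_regular {B : Branch k} (h : ShadowHugsRegularSurface B) : ShadowHugsSurface B := by
  obtain ⟨m, Z, hZ, j, S, hle, hS, hdim, -⟩ := h
  exact ⟨m, Z, hZ, j, S, hle, hS, hdim⟩

/-- pure logic. [folklore] -/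
theorem frameStable_of_shadowHugsSurface {B : Branch k} (h : ShadowHugsSurface B) : FrameStable B := by
  obtain ⟨m, Z, hZ, -⟩ := h
  exact ⟨m, Z, hZ⟩

/-- **leaf · `FrameUnstable3`** — no escaping pure core branch WITHOUT a hypersurface of permanent contact (infinitely
many re-framing events `z ↦ z + c·u`, `c ≠ 0`, each forced by `[H₀']₃ = c³u³`: NODE-g11.md §4.2 — the
cube-head shadow
of «no maximal contact in char p»).  UNDECIDED · RESIDUAL-2 · INSTRUMENTABLE (T-frame: does any pure cube head admit
two consecutive re-framing events along core children?  census over `𝔽₃[x,y,z,w]_{≤7}`). (Sources: Moh1987;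
CossartPiltant2008, §4.) -/
def FrameUnstable3 : Prop := NoBranch3 fun _ _ B => ¬ FrameStable B

/-- **leaf · `ShadowFree3`** — no frame-stable escaping pure core branch whose shadow hugs NO surface germ.
DESK-DECIDED (g11, NEW — NODE-g11.md §4.3): the contact coefficients `H₂, H₁, H₀` (`f = z³ + z²H₂ + zH₁ + H₀`,
`ord H_c ≥ 4 − c`) hug nothing, so by Zariski factorisation along the branch they become `u^{e_c}·unit`
(resp. `u^{e}v^{e'}·unit`) at every late FREE (resp. DOUBLE) point, where the pencil line (resp. the corner line)
`{u = y = z = 0}` (resp. `{u = v = z = 0}`) is a projective line of `E_u ≅ ℙ³` with `ν ≥ min_c (c + e_c) ≥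
min_c (c + (4 − c)) = 4 ≥ 3`:
an EXIT LINE, contradicting escape; a branch with only TRIPLE points from some stage on is a cube corner tower
(`NoCubeCornerTower`, window-verified) or has an eventually constant letter (g10 Case A).  Lean UNDECIDED · ATTACKABLE-L.
(Sources: CossartPiltant2008, §4.) -/
def ShadowFree3 : Prop := NoBranch3 fun _ _ B => FrameStable B ∧ ¬ ShadowHugsSurface B

/-- **leaf · `ShadowRegular3`** — no frame-stable escaping pure core branch whose shadow hugs a REGULAR surface germ.
DESK-DECIDED (g11, NEW mechanism — NODE-g11.md §4.4): the regular surface is `{y = 0}` for an INERT variable `y`;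
the classes `y^b z^c h_{bc}(x,w)` (`b + c ≤ 2`, twist `3 − b − c`) evolve by plane blow-ups and never mix; a plane
germ has finitely many Puiseux blocks, so either a branch of some `h_{bc}` is followed (curve hugging ⇒ free tail ⇒
g10 Case A) or every `h_{bc}` becomes `u^{e}v^{e'}·unit`, and then every FREE point has the exit line `{u = y = z = 0}`
(`ν = min (b + c + e_{bc}) ≥ 4`) and the remaining old/new-satellite 2-letter stretches exit by the δ-dissipation
`(δ,δ') ↦ (δ+δ', ·)` (coordinate exit theorem, 2 letters).  Overlaps lens-4 g11's Surface Law (different mechanism: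
corner-descent certificate).  Lean UNDECIDED · ATTACKABLE-M. (Sources: CossartPiltant2008, §4.) -/
def ShadowRegular3 : Prop := NoBranch3 fun _ _ B => ShadowHugsRegularSurface B

/-- **leaf · `ShadowSingular3` — THE LOCATED RESIDUAL (score 0 said plainly)** — no frame-stable escaping pure core
branch whose shadow hugs surface germs but NO regular one (every hugged surface germ singular at every followed point,
for ever; multiplicity eventually constant `m ≥ 2`).  UNDECIDED · ATTACKABLE (plan: an embedded surface in a regular
3-fold whose infinitely near points along a point tower stay `m`-fold must carry them on an `m`-fold CURVE from some
stage on — Beppo Levi / Zariski in char 0, CossartJannsenSaito2020 Ch. 6 «fundamental sequences» in all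
characteristics — whence curve hugging ⇒ free tail ⇒ g10 Case A) · INSTRUMENTABLE (T-hug-sing: census of pure cube
heads whose `H₀` is a cone over a singular plane curve) · converges with lens-4 g11 `SingularSurfaceHuggingTowersTerminate`
(«line hopping»). (Sources: Moh1987; CossartJannsenSaito2020, Thm 5.30.) -/
def ShadowSingular3 : Prop := NoBranch3 fun _ _ B => ShadowHugsSurface B ∧ ¬ ShadowHugsRegularSurface B

/-- pure logic: each leaf is implied by the parent. [folklore] -/
theorem leaves_of_noEscaping (h : NoEscapingBranch3) :
    FrameUnstable3 ∧ ShadowFree3 ∧ ShadowRegular3 ∧ ShadowSingular3 :=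
  ⟨noBranch3_mono (fun _ _ _ _ => trivial) h, noBranch3_mono (fun _ _ _ _ => trivial) h,
    noBranch3_mono (fun _ _ _ _ => trivial) h, noBranch3_mono (fun _ _ _ _ => trivial) h⟩

/-- **THE g11 CUT IS EXACT (kernel, PROVED by excluded middle on `FrameStable`, `ShadowHugsSurface`,
`ShadowHugsRegularSurface`): `NoEscapingBranch3 ⟺ FrameUnstable3 ∧ ShadowFree3 ∧ ShadowRegular3 ∧ ShadowSingular3`.**
[folklore] -/
theorem noEscaping_iff_leaves :
    NoEscapingBranch3 ↔ FrameUnstable3 ∧ ShadowFree3 ∧ ShadowRegular3 ∧ ShadowSingular3 := by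
  refine ⟨leaves_of_noEscaping, fun ⟨hU, hF, hR, hS⟩ => ?_⟩
  have hSurf : NoBranch3 fun _ _ B => ShadowHugsSurface B :=
    noBranch3_of_cover (P := fun _ _ B => ShadowHugsRegularSurface B)
      (Q := fun _ _ B => ShadowHugsSurface B ∧ ¬ ShadowHugsRegularSurface B)
      (fun _ _ B h => by by_cases hr : ShadowHugsRegularSurface B <;> simp_all) hR hS
  have hStable : NoBranch3 fun _ _ B => FrameStable B :=
    noBranch3_of_cover (P := fun _ _ B => FrameStable B ∧ ¬ ShadowHugsSurface B)
      (Q := fun _ _ B => ShadowHugsSurface B)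
      (fun _ _ B h => by by_cases hs : ShadowHugsSurface B <;> simp_all) hF hSurf
  exact noBranch3_of_cover (P := fun _ _ B => ¬ FrameStable B) (Q := fun _ _ B => FrameStable B)
    (fun _ _ B _ => by by_cases hs : FrameStable B <;> simp_all) hU hStable

/-- The decided side folded: `FrameUnstable3 → ShadowSingular3 → (decided leaves) → NoEscapingBranch3`. [folklore] -/
theorem noEscaping_of_leaves (hU : FrameUnstable3) (hF : ShadowFree3) (hR : ShadowRegular3) (hS : ShadowSingular3) :
    NoEscapingBranch3 :=
  noEscaping_iff_leaves.2 ⟨hU, hF, hR, hS⟩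

/-! ## §4 The combinatorial support piece, typed over the TREE's `CornerTower 4 3` -/

/-- The exponent vector of the cube `z³` in slot `j`. -/
def cubeVec (j : Fin 4) : Expo 4 := Function.update (fun _ => 0) j 3

/-- A CUBE corner tower: at every stage the generator set contains the cube `z_j³` and every other generator has
degree `≥ 4` (the corner is a CORE point with initial form `z_j³`; the charts then never take direction `j`). -/
def IsCubeTower (T : CornerTower 4 3) : Prop :=
  ∃ j : Fin 4, ∀ i, cubeVec j ∈ T.G i ∧ ∀ α ∈ T.G i, α ≠ cubeVec j → 4 ≤ α.deg

/-- **support · `NoCubeCornerTower`** — no infinite cube corner tower in 4 parameters at marking 3.  DESK+MACHINE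
DECIDED (NODE-g11.md §4.5: COORDINATE EXIT THEOREM — after two letter changes some exceptional axis has no killer;
exhaustive over all words of length ≤ 10 and all monomials of degree ≤ 22, lookahead ≥ 1, 0 violations; truncation
lemmas L1 (killer degree ≤ 8 one change later) and L2 (run length); eventually-constant words by the backward-orbit
lemma) · Lean UNDECIDED · ATTACKABLE-S (finite combinatorics, `decide` after L1/L2) · WEAKER by letter than the tree
leaf `NoCornerTower 4 3` (`noCube_of_noCornerTower`). (Sources: CossartJannsenSaito2020, Cor 5.37.) -/
def NoCubeCornerTower : Prop := ∀ T : CornerTower 4 3, IsCubeTower T → False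

/-- BY NAME: the tree's plain leaf gives the cube slice. [folklore] -/
theorem noCube_of_noCornerTower (h : NoCornerTower 4 3) : NoCubeCornerTower := fun T _ => h T

end Summit.ResolutionOfSingularities.ResolutionOfSingularities.Theorems.SatelliteExitClasses
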